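import Summits.CriticalPhenomena.CardyFormulaZ2.Theses.CardyRotToConf
import Summits.CriticalPhenomena.CardyFormulaZ2.Theorems.CardyRotToConfR2SymmetryUpgrade.Negative.CruxConsequences
import Summits.CriticalPhenomena.CardyFormulaZ2.Theorems.CardyRotToConfR2SymmetryUpgradeNonTracing
import Literature.Probability.RandomPlanarGeometry.SLEDomainMarkov
import Literature.Probability.RandomPlanarGeometry.SLEExistenceNeEightHolds
import Literature.Probability.RandomPlanarGeometry.SLESixSplittingReduction
import Literature.Probability.RandomPlanarGeometry.SLESixLocality
import Literature.Probability.RandomPlanarGeometry.SLESixMoebiusLocalityProofs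
import Literature.Probability.RandomPlanarGeometry.SLESixHullLocalityReductionNbhd
import Literature.Probability.RandomPlanarGeometry.SLESixLocalityOfBounded
import Literature.Probability.RandomPlanarGeometry.SLESixHullLocalityNbhdProved
import Literature.Probability.RandomPlanarGeometry.ConformalRestrictionCovariance
import Literature.Probability.RandomPlanarGeometry.CaratheodoryHalfPlaneProofs
import Literature.Probability.RandomPlanarGeometry.LocalMartingaleProofs
import HarnessLib

/-!
# `¬ CardyRotToConfR2SymmetryUpgrade` from two published locality theorems and a second family
# (negative lane of crux `stmt-CriticalPhenomena-0698`, line `germ-label-transport`)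

Kernel-checked record of the reduction driven by the line lead: the typed crux R2 is refuted by
two admissible non-tracing families that differ on the unit disc (`not_crux_of_two_families`).
Family one is ANY family `Q` of chordal SLE₆ laws; its admissibility is PROVED here except for the
two locality theorems of the literature, taken as hypotheses in their tree form:

* `IsSLELaw.locality_six` — Lawler–Schramm–Werner (2001) Thm 2.2 / Cor 2.4 (restriction form of
  the locality of SLE₆), `SLESixLocality.lean`;
* `sle_six_moebius_locality` — Lawler (2005) Thm 6.13 / Prop 6.14 for `(ℍ; 0, x, ∞)` (Möbius
  form of target independence), `SLESixMoebiusLocality.lean`, from which target independence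
  follows (`SLESixSplittingReduction.lean`);

chordality, similarity covariance, the typed DOMAIN MARKOV PROPERTY
(`ChordalFamily.isDomainMarkov_of_isSLELaw`, all `κ > 0`, `SLEDomainMarkov.lean`) and non-tracing
(`stub_nonTracing`) are theorems of the tree. Family two is the third hypothesis (the registered
stub `stub_secondFamily` of the line, stated inline: the disprover's one-shot round-germ surgery
of `Q`, Disproof §14, with the SLE₆ regularity it needs).

* `isLocalMarkovChordalFamily_of_isSLELaw_six_of_facts` — admissibility of the SLE₆ family
  modulo the two locality theorems;
* **`CardyRotToConfR2SymmetryUpgrade_false_of_facts`** (registered stub) — the three hypotheses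
  imply `¬ R2`.
-/

noncomputable section

open MeasureTheory
open Literature.Probability.RandomPlanarGeometry
open Literature.Probability.RandomPlanarGeometry.ChordalFamily
open Summit.CriticalPhenomena.CardyFormulaZ2.Theses.CardyRotToConf
open Summit.CriticalPhenomena.CardyFormulaZ2.Theorems.CardyRotToConfR2SymmetryUpgrade
open Summit.CriticalPhenomena.CardyFormulaZ2.Theorems.CardyRotToConfR2SymmetryUpgrade.Negative

namespace Summit.CriticalPhenomena.CardyFormulaZ2.Theorems.CardyRotToConfR2SymmetryUpgrade.Negative

/-- A family of chordal SLE₆ laws exists (Rohde–Schramm, proved in the tree). [folklore] -/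
theorem exists_sleSixLawFamily' :
    ∃ Q : ChordalFamily, ∀ D : DobrushinDomain, IsSLELaw 6 D (Q D) :=
  ⟨fun D => (exists_isSLELaw_of_ne_eight (κ := 6) (by norm_num) (by norm_num) D).choose,
    fun D => (exists_isSLELaw_of_ne_eight (κ := 6) (by norm_num) (by norm_num) D).choose_spec⟩

/-- **Admissibility of the chordal SLE₆ family modulo the two locality theorems.**
[cite: Werner2007, §3.2 and Prop 3.4] -/
theorem isLocalMarkovChordalFamily_of_isSLELaw_six_of_facts (hloc : IsSLELaw.locality_six)
    (hmoeb : sle_six_moebius_locality) {Q : ChordalFamily}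
    (hQ : ∀ D : DobrushinDomain, IsSLELaw 6 D (Q D)) : IsLocalMarkovChordalFamily Q := by
  haveI : Fact Literature.Probability.Process.isProjectiveLimit_preWienerMeasure :=
    ⟨isProjectiveLimit_preWienerMeasure_holds⟩
  refine ⟨fun D => ⟨(hQ D).isProbabilityMeasure,
      (hQ D).ae_endpoints JordanDomain.mapsTo_boundaryExtension_holds⟩,
    (ChordalFamily.isConformallyCovariant_of_isSLELaw hQ).isSimilarityCovariant,
    ChordalFamily.isDomainMarkov_of_isSLELaw (by norm_num) hQ,
    ChordalFamily.isLocal_of_isSLELaw_six hloc hQ,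
    ChordalFamily.isTargetIndependent_of_isSLELaw_six_of_moebius hmoeb hQ⟩

/-- **`¬ R2` from the two locality theorems and the second family** (registered stub
`CardyRotToConfR2SymmetryUpgrade_false_of_facts`; hypotheses: LSW locality in restriction form,
Lawler's Möbius form of target independence, and the one-shot-surgery second family).
[cite: Werner2007, §3.2] -/
theorem CardyRotToConfR2SymmetryUpgrade_false_of_facts : IsSLELaw.locality_six → sle_six_moebius_locality → (∀ Q : ChordalFamily, (∀ D : DobrushinDomain, IsSLELaw 6 D (Q D)) → IsLocalMarkovChordalFamily Q → (∀ D : DobrushinDomain, ∀ᵐ γ ∂(Q D), ∀ c : Curve ℂ, CurveClass.mk c = γ → ∀ s t : unitInterval, s < t → c '' Set.Icc s t ⊆ frontier D.carrier → (c '' Set.Icc s t).Subsingleton) → ∃ J : ChordalFamily, IsLocalMarkovChordalFamily J ∧ (∀ D : DobrushinDomain, ∀ᵐ γ ∂(J D), ∀ c : Curve ℂ, CurveClass.mk c = γ → ∀ s t : unitInterval, s < t → c '' Set.Icc s t ⊆ frontier D.carrier → (c '' Set.Icc s t).Subsingleton) ∧ J DobrushinDomain.unitDisc ≠ Q DobrushinDomain.unitDisc)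 → ¬ CardyRotToConfR2SymmetryUpgrade := by
  intro hloc hmoeb hsec
  obtain ⟨Q, hQ⟩ := exists_sleSixLawFamily'
  have hadm := isLocalMarkovChordalFamily_of_isSLELaw_six_of_facts hloc hmoeb hQ
  have hnt := stub_nonTracing Q hQ
  obtain ⟨J, hJ, hJnt, hne⟩ := hsec Q hQ hadm hnt
  exact not_crux_of_two_families hJ hJnt hadm hnt hne

/-- **`¬ R2` from LSW locality and the second family alone** (registered stub
`CardyRotToConfR2SymmetryUpgrade_false_of_locality_of_secondFamily`): the Möbius form of target
independence is now a theorem of the tree (`sle_six_moebius_locality_holds`,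
`SLESixMoebiusLocalityProofs.lean`), so only the restriction form of locality (LSW 2001 Thm 2.2 /
Cor 2.4) and the one-shot-surgery family remain as hypotheses. [cite: Werner2007, §3.2] -/
theorem CardyRotToConfR2SymmetryUpgrade_false_of_locality_of_secondFamily : IsSLELaw.locality_six → (∀ Q : ChordalFamily, (∀ D : DobrushinDomain, IsSLELaw 6 D (Q D)) → IsLocalMarkovChordalFamily Q → (∀ D : DobrushinDomain, ∀ᵐ γ ∂(Q D), ∀ c : Curve ℂ, CurveClass.mk c = γ → ∀ s t : unitInterval, s < t → c '' Set.Icc s t ⊆ frontier D.carrier → (c '' Set.Icc s t).Subsingleton) → ∃ J : ChordalFamily, IsLocalMarkovChordalFamily J ∧ (∀ D : DobrushinDomain, ∀ᵐ γ ∂(J D), ∀ c : Curve ℂ, CurveClass.mk c = γ → ∀ s t : unitInterval, s < t → c '' Set.Icc s t ⊆ frontier D.carrier → (c '' Set.Icc s t).Subsingleton) ∧ J DobrushinDomain.unitDisc ≠ Q DobrushinDomain.unitDisc) → ¬ CardyRotToConfR2SymmetryUpgrade :=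
  fun hloc hsec ↦ CardyRotToConfR2SymmetryUpgrade_false_of_facts hloc sle_six_moebius_locality_holds hsec

/-- **`¬ R2` from the two remaining locality GAPS and the second family** (registered stub
`CardyRotToConfR2SymmetryUpgrade_false_of_gaps`): the alive half-plane locality of SLE₆ w.r.t. a
bounded hull being a theorem of the tree (`sle_six_hull_locality_alive_holds`) and the Jordan
hull-subdomain clause following from the neighbourhood curve-hitting form
(`IsSLELaw.locality_six_bounded_of_hull_nbhd`), the restriction form of locality enters only through
(a) the neighbourhood curve-hitting half-plane form `sle_six_hull_locality_nbhd` (swallowed clusters)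
and (b) the passage from the hull-subdomain clause to all subdomains (buried targets).
[cite: Werner2007, §3.2] -/
theorem CardyRotToConfR2SymmetryUpgrade_false_of_gaps : sle_six_hull_locality_nbhd → (IsSLELaw.locality_six_bounded → IsSLELaw.locality_six) → (∀ Q : ChordalFamily, (∀ D : DobrushinDomain, IsSLELaw 6 D (Q D)) → IsLocalMarkovChordalFamily Q → (∀ D : DobrushinDomain, ∀ᵐ γ ∂(Q D), ∀ c : Curve ℂ, CurveClass.mk c = γ → ∀ s t : unitInterval, s < t → c '' Set.Icc s t ⊆ frontier D.carrier → (c '' Set.Icc s t).Subsingleton) → ∃ J : ChordalFamily, IsLocalMarkovChordalFamily J ∧ (∀ D : DobrushinDomain, ∀ᵐ γ ∂(J D), ∀ c : Curve ℂ, CurveClass.mk c = γ → ∀ s t : unitInterval, s < t → c '' Set.Icc s t ⊆ frontier D.carrier → (c '' Set.Icc s t).Subsingleton) ∧ J DobrushinDomain.unitDisc ≠ Q DobrushinDomain.unitDisc) → ¬ CardyRotToConfR2SymmetryUpgrade :=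
  fun hnbhd hbur hsec ↦ CardyRotToConfR2SymmetryUpgrade_false_of_locality_of_secondFamily
    (hbur (IsSLELaw.locality_six_bounded_of_hull_nbhd hnbhd)) hsec

/-- **`¬ R2` from the neighbourhood half-plane locality and the second family alone** (registered
stub `CardyRotToConfR2SymmetryUpgrade_false_of_nbhd_of_secondFamily`): the buried-target passage
`IsSLELaw.locality_six_of_bounded` being a theorem of the tree (`SLESixLocalityOfBounded.lean`), the
only locality input left is `sle_six_hull_locality_nbhd` (the alive half-plane form is proved,
`sle_six_hull_locality_alive_holds`; what remains is the passage through the swallowing instants).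
[cite: Werner2007, §3.2] -/
theorem CardyRotToConfR2SymmetryUpgrade_false_of_nbhd_of_secondFamily : sle_six_hull_locality_nbhd → (∀ Q : ChordalFamily, (∀ D : DobrushinDomain, IsSLELaw 6 D (Q D)) → IsLocalMarkovChordalFamily Q → (∀ D : DobrushinDomain, ∀ᵐ γ ∂(Q D), ∀ c : Curve ℂ, CurveClass.mk c = γ → ∀ s t : unitInterval, s < t → c '' Set.Icc s t ⊆ frontier D.carrier → (c '' Set.Icc s t).Subsingleton) → ∃ J : ChordalFamily, IsLocalMarkovChordalFamily J ∧ (∀ D : DobrushinDomain, ∀ᵐ γ ∂(J D), ∀ c : Curve ℂ, CurveClass.mk c = γ → ∀ s t : unitInterval, s < t → c '' Set.Icc s t ⊆ frontier D.carrier → (c '' Set.Icc s t).Subsingleton) ∧ J DobrushinDomain.unitDisc ≠ Q DobrushinDomain.unitDisc) → ¬ CardyRotToConfR2SymmetryUpgrade :=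
  fun hnbhd hsec ↦ CardyRotToConfR2SymmetryUpgrade_false_of_gaps hnbhd IsSLELaw.locality_six_of_bounded hsec

/-- **`¬ R2` from the second family ALONE** (registered stub
`CardyRotToConfR2SymmetryUpgrade_false_of_secondFamily`): the locality of chordal SLE₆ — S3 of the line,
`IsSLELaw.locality_six_holds` (`SLESixHullLocalityNbhdProved.lean`: alive image chain, passage through
the swallow instants, buried targets) — being a THEOREM of the tree, the refutation of the crux is
conditional only on the existence of a second admissible family differing from SLE₆ on the unit disc
(S7, the one-shot surgery). [cite: Werner2007, §3.2] -/
theorem CardyRotToConfR2SymmetryUpgrade_false_of_secondFamily : (∀ Q : ChordalFamily, (∀ D : DobrushinDomain, IsSLELaw 6 D (Q D)) → IsLocalMarkovChordalFamily Q → (∀ D : DobrushinDomain, ∀ᵐ γ ∂(Q D), ∀ c : Curve ℂ, CurveClass.mk c = γ → ∀ s t : unitInterval, s < t → c '' Set.Icc s t ⊆ frontier D.carrier → (c '' Set.Icc s t).Subsingleton) → ∃ J : ChordalFamily, IsLocalMarkovChordalFamily J ∧ (∀ D : DobrushinDomain, ∀ᵐ γ ∂(J D), ∀ c : Curve ℂ,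 CurveClass.mk c = γ → ∀ s t : unitInterval, s < t → c '' Set.Icc s t ⊆ frontier D.carrier → (c '' Set.Icc s t).Subsingleton) ∧ J DobrushinDomain.unitDisc ≠ Q DobrushinDomain.unitDisc) → ¬ CardyRotToConfR2SymmetryUpgrade :=
  fun hsec ↦ CardyRotToConfR2SymmetryUpgrade_false_of_locality_of_secondFamily
    IsSLELaw.locality_six_holds hsec

end Summit.CriticalPhenomena.CardyFormulaZ2.Theorems.CardyRotToConfR2SymmetryUpgrade.Negative

end
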